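import Mathlib
import HarnessLib
import HarnessLib.Audit
import Summits.CriticalPhenomena.Statement

/-!
Route: PercSupergraphDichotomy

CLOSED (refuted) 2026-08-28T22:31:41Z by gate — reason: refuted:stmt-CriticalPhenomena-11898 (SupergraphContinuity) by Summit.CriticalPhenomena.PercolationContinuityZ3.Theorems.CCDShell.not_SupergraphContinuity — note: repair grace of 72.0 h (deadline 2026-08-28T22:27:37Z) expired without a repair — closed by the gate. The file is kept as the record of this route; refuted decls are indexed as negative knowledge (`ledger negatives`).

# Route PercSupergraphDichotomy — supergraph dichotomy — continuity for every unit-cube supergraph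
of Z^3 with the same p_c, or the Chayes-Chayes-Durrett graph

It suffices to show X = SUPERGRAPH CONTINUITY: for every simple graph G on the vertex set of ℤ³ with
ℤ³ ≤ G ≤ the unit-cube graph
(every extra edge joins sites at sup-distance 1: degree ≤ 26, cubic growth, identity map a rough
isometry onto ℤ³, 3-d isoperimetry)
and with the SAME critical point, criticalProb G 0 = criticalProb ℤ³ 0, Bernoulli bond percolation
on G has θ_G(0; p_c(ℤ³)) = 0.
X → PercolationContinuityZ3 by instantiating G := ℤ³ (deciding theorem `closes`, pure logic). The
route realises the NEGATIVE-SIDE card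
ccd-decorated-lattice as a typed dichotomy: its rank-2 crux CCDGraphZ3 (the Chayes–Chayes–Durrett
graph over ℤ³) is EXACTLY ¬X
(support DichotomyLink: CCDGraphZ3 ↔ ¬X, proved in Sketch.lean), so the route is settled either way
— X proved closes the conjunct with
room to spare (continuity is then a property of the whole uncatalogued class), X refuted records in
the negatives index the sharpest
barrier of this sub: a bounded-degree cubic-growth supergraph of ℤ³ with unchanged p_c percolating
at p_c, i.e. transitivity must be
used beyond geometry, independence, FKG/BK/Russo, finite energy and amenable uniqueness. The
planner's bet is refutation (card r2).
Lean: `∀ G : SimpleGraph (Literature.Probability.LatticeModels.Site 3),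
Literature.Probability.LatticeModels.zdGraph 3 ≤ G → (∀ x y :
Literature.Probability.LatticeModels.Site 3, G.Adj x y → ∀ i, |x i - y i| ≤ 1) →
Literature.Probability.Percolation.criticalProb G 0 =
Literature.Probability.Percolation.criticalProb (Literature.Probability.LatticeModels.zdGraph 3) 0 →
Literature.Probability.Percolation.theta G 0 (Literature.Probability.Percolation.criticalProbI 3) =
0`

## Assembly
Pure logic (sorry-free in Sketch.lean, `closes` / `assembly_provable`): PercolationContinuityZ3
unfolds (percolationContinuityZ3_iff,
criticalProbI) to theta (zdGraph 3) 0 (criticalProbI 3) = 0; instantiate X at G := zdGraph 3 with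
zdGraph 3 ≤ zdGraph 3 (le_rfl), the
sup-distance-1 clause from zdGraph_adj_iff (y = x ± e_j), and criticalProb (zdGraph 3) 0 =
criticalProb (zdGraph 3) 0 (rfl). The
negative horn is deliberately NOT an antecedent: CCDGraphZ3 ↔ ¬X (DichotomyLink), and CCDGraphZ3 ⇐
ranks 4, 5 + supports via ShellGluing.
The positive horn reaches X through ONE typed glue edge, the support PositiveHorn : ¬CCDGraphZ3 → X
(badge repair 2026-08-16,
proved in Sketch.lean: θ ≥ 0 turns ¬(0 < θ_G) into θ_G = 0): the route proves the conjunct exactly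
when the rank-2 crux is REFUTED
(¬CCDGraphZ3, PositiveHorn, closes) and refutes X exactly when it is PROVED (DichotomyLink); no
finer positive decomposition is claimed.

Rationale: WHY THIS LINE. Chayes–Chayes–Durrett (ChayesChayesDurrett1987, Thm 2;
doi:10.1088/0305-4470/20/6/034) tune the PARAMETER p(x) ↓ p_c on ℤ² so slowly
that supercritical shells glue into an incipient infinite cluster; the card tunes the GRAPH instead
at the single parameter p_c(ℤ³):
on dyadic shell k, ℤ³ is decorated by the mℤ³-periodic unit-cube gadget D_{m_k} (m_k = 2^k m₀,
nested patterns), strictly supercritical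
at p_c(ℤ³) by Aizenman–Grimmett essential enhancement (AizenmanGrimmett1991 =
GrimmettPercolation1999 §3.3; MartineauSevero2019 Prop 4.2,
whose AG line argument is PROVED in tree, EnhancementAGLine/EnhancementProp42) made slab-visible by
Grimmett–Marstrand (GrimmettMarstrand1990,
PROVED in tree: GrimmettMarstrand1990_blocks/planeBlocks_holds), so static renormalisation
(GrimmettPercolation1999 Thm (7.61), Lemma
(7.78) PROVED in tree as StaticRenormalizationSlabs; Pisztora1996; ContrerasMartineauTassion2024 for
the polynomial-growth variant) makes
its blocks good with summable failure, radii being chosen AFTER the patterns; sparser patterns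
outward keep p_c(G) = p_c(ℤ³) by a BK
branching comparison resting on quasi-transitive sharpness (DuminilCopinTassionCMP2016, PROVED in
tree: SharpnessQuasiTransitiveSusceptibility).
Imported areas: inhomogeneous/incipient percolation (CCD), strict critical-point inequalities (AG,
Martineau–Severo), supercritical
coarse graining (GM, Pisztora, CMT), planar duality for the d = 2 warm-up (BollobasRiordan2008).
What it does that prior routes and the
negatives index do not: the closed PercCCDGraph concluded the barrier, not the conjunct (retired
not-a-thesis); this route DECIDES the
conjunct through X (D-0027) while staffing the same constructions, in the pattern of
PercPotemkinWeaver — which perturbs the MEASURE on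
ℤ³, whereas X/¬X perturb the GRAPH under the product measure; X is the statement that the barrier
audit of TreesPercolatingAtCriticality
(gen 1, 2026-08-15: LogWedgePercolatingAtCriticality) names as the only uncatalogued class —
rough-isometric to ℤ^d, 3-d isoperimetry,
p_c(G) = p_c(ℤ^d); the 6 negatives of the summit are untouched.

RANKED CRUXES. #0 SupergraphContinuity (target) — X — every simple graph G with ℤ³ ≤ G ≤ unit-cube
graph (extra edges only between sites at sup-distance 1) and criticalProb G 0 = criticalProb ℤ³ 0
has θ_G(0; p_c(ℤ³)) = 0 (positive horn of the dichotomy; instantiates to the conjunct at G = ℤ³).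
(why it might fail: Expected FALSE: CCDGraphZ3 (rank 2) is exactly ¬X — density-zero nested
unit-cube decorations, supercritical shell by shell at p_c(ℤ³), glue CCD-style; X survives only if
periodic essential enhancements of ℤ³ were not slab-supercritical at p_c(ℤ³).)
[ChayesChayesDurrett1987, AizenmanGrimmett1991, GrimmettMarstrand1990, HeydenreichVanDerHofstad2017,
BenjaminiSchramm1996]
#2 CCDGraphZ3 (crux) — the Chayes–Chayes–Durrett graph over ℤ³ (card r2; = ¬X): a unit-cube
supergraph G of ℤ³ (same vertices, extra edges only between sites at sup-distance 1) with
criticalProb G 0 = criticalProb ℤ³ 0 and θ_G(0; p_c(ℤ³)) > 0. Intended G: ℤ³ decorated on dyadic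
shells [2^{J_k}, 2^{J_{k+1}}) by the periodic 26-neighbour gadget at the sites of (m_k ℤ)³, m_k =
2^k m₀ (nested patterns D_{m_{k+1}} ≤ D_{m_k}), radii J_k chosen AFTER the patterns so that the
bad-block probabilities of shell k sum to ≤ 2^{-k}. [deps: DecoratedSlabsSupercritical,
SlabsToBlocks, EnhancementThresholdLimit, ShellGluing] [difficulty: XL] (why it might fail: Only
through the engine: needs each periodic decoration D_m strictly slab-supercritical at p_c(ℤ³) (rank
4) and summable bad blocks on D_m (rank 5); if AG's gain does not beat the GM slab gap for any m the
shell gluing has nothing to run on.) [ChayesChayesDurrett1987, AizenmanGrimmett1991,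
GrimmettMarstrand1990, GrimmettPercolation1999, Pisztora1996, AngelHutchcroft2018]
#9 CCDGraphZ2 (support since the 2026-08-16 badge repair; filed as crux rank 3 at open, demoted
because it is DANGLING in the obligation graph — consumed by neither `closes` nor any glue item — so
it must not key a crux chain; it stays filed: provable when idle, refutable, the cheapest sanity
check of the CCD-with-graph design and a recorded kill criterion) — planar warm-up (card r4): a
unit-square supergraph G of ℤ² (extra edges only between sites at sup-distance 1) with criticalProb
G 0 = criticalProb ℤ² 0 and θ_G(0; p_c(ℤ²)) > 0. Intended: one NE-diagonal per face on the lines m_k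
∣ x₀ − x₁ (still PLANAR, 2-fold symmetric, period m_k), sparser on outer dyadic shells; on shell k
the decorated planar lattice is strictly supercritical at 1/2 (planar AG / Kesten ch. 10
close-packing inequality), its planar dual strictly subcritical (p_c(D)+p_c(D*) = 1,
BollobasRiordan2008; quasi-transitive sharpness PROVED in tree), so open circuits in dyadic annuli
fail summably and glue by planarity — CCD87's proof with the graph in place of the parameter.
[difficulty: L] (why it might fail: Needs p_c(D)+p_c(D*)=1 for the 2-fold-symmetric decorated planar
lattice (BollobasRiordan2008's symmetry hypotheses must cover it) or an RSW theory for it, plus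
strict p_c(D) < 1/2; a gadget lacking the symmetry breaks the duality step.)
[ChayesChayesDurrett1987, BollobasRiordan2008, Kesten1982, AizenmanGrimmett1991,
DuminilCopinTassionCMP2016, Zhang1994]
#4 DecoratedSlabsSupercritical (crux) — for every period m ≥ 1 the decorated lattice D_m := ℤ³ ⊔
{all unit-cube edges at the sites of (mℤ)³} has a slab S_K = {0 ≤ x₂ ≤ K} whose induced graph has
critical point (at the origin) STRICTLY below p_c(ℤ³) (card r3/S3 in the refuter's fixed-pattern
form; no uniformity in m). Two proofs foreseen: (i) Grimmett–Marstrand for ℤ³ (PROVED in tree) plus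
an Aizenman–Grimmett gain p_c(S_K(ℤ³)) − p_c(S_K(D_m)) ≥ δ(m) > 0 uniform in K ≥ K₀(m); (ii) port
GM's block theorem to the mℤ³-periodic, hyperoctahedrally symmetric D_m and use AG /
Martineau–Severo Prop 4.2 on the full lattice. [difficulty: L] (why it might fail: Needs the AG gain
in slabs bounded below uniformly in the width K (to beat the GM gap p_c(S_K)−p_c → 0) or a
Grimmett–Marstrand theorem for the quasi-transitive D_m; both expected, neither written, and BBR
(arXiv:1402.0834) found gaps in AG-type proofs.) [AizenmanGrimmett1991, GrimmettMarstrand1990,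
GrimmettPercolation1999, BalisterBollobasRiordan2014, MartineauSevero2019,
ContrerasMartineauTassion2024]
#5 SlabsToBlocks (crux) — static renormalisation for the decorated lattices (Grimmett 1999 Thm
(7.61) / Pisztora ported to D_m): if some slab of D_m has critical point strictly below p, then at
parameter p the block events — (a) the box B(x,n), n = 2^j, contains an open cluster joining, inside
B(x,n), the two opposite faces in each of the three directions; (b) any two open paths inside
B(x,3n), each of sup-extent ≥ n, are joined by an open path inside B(x,3n) — fail with probability
whose supremum over the centre x is summable along the dyadic scales (exponential in n expected;
periodicity makes the supremum a finite maximum). The fixed-pattern engine of the shell gluing.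
[deps: DecoratedSlabsSupercritical] [difficulty: XL] (why it might fail: Thm (7.61)/Lemma (7.89)
(crossing cluster + local uniqueness by peeling with slab seeds and p′<p sprinkling) are written for
ℤ^d using all its symmetries; D_m is only mℤ³-periodic, and (b) is asked for boundary-hugging paths
of B(x,3n) at a summable rate.) [GrimmettPercolation1999, Pisztora1996, GrimmettMarstrand1990,
ContrerasMartineauTassion2024]
#9 EnhancementThresholdLimit (support) — the critical points of the decorated lattices tend to
p_c(ℤ³) as the decoration rarefies: for every real p < p_c(ℤ³) there is M with p < p_c(D_m) for all
m ≥ M (card S2). Proof: at p′ ∈ (p, p_c(ℤ³)) the ℤ³-susceptibility is finite (PROVED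
quasi-transitive sharpness), so a self-avoiding open path of D_m decomposes into edge-disjoint
ℤ³-segments separated by gadget edges at decorated sites pairwise ≥ m − 2 apart; BK gives a
branching bound with mean offspring ≤ 27·26·Σ_{‖w‖≥m−2} τ_{p′}(w) → 0, hence θ_{D_m}(p′) = 0 and p <
p′ ≤ p_c(D_m) for m ≥ M(p′). [difficulty: M] [GrimmettPercolation1999, DuminilCopinTassionCMP2016,
AntunovicVeselic2007]
#9 ShellGluing (support) — glue of the foreseen split of CCDGraphZ3 (the CCD shell construction with
patterns fixed first and radii chosen afterwards): DecoratedSlabsSupercritical → SlabsToBlocks →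
EnhancementThresholdLimit → CCDGraphZ3. Content: nested patterns m_k = 2^k m₀; by ranks 4–5 at p =
p_c(ℤ³) the bad-block suprema ε_{m_k}(2^j) are summable in j, so choose J_k ↑ with Σ_{j ≥ J_k − 1}
ε_{m_k}(2^{j−3}) ≤ 2^{−k}/C (C = blocks of scale 2^{j−3} per dyadic annulus); G = ℤ³ ⊔ (gadget edges
of D_{m_k} inside shell 2^{J_k} ≤ ‖x‖ < 2^{J_{k+1}}); evaluate each block on ω ∩ E(D^{(x)}), D^{(x)}
the COARSEST pattern meeting B(x, 3·2^{j−3}) (its edges lie in G by nestedness; equal product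
marginals); neighbouring and cross-scale good blocks glue through clause (b) of the finer block; so
with positive probability all blocks beyond a finite annulus are good, some vertex percolates, and
θ_G(0) > 0 by theta_pos_of_adj (PROVED in tree); hence p_c(G) ≤ p_c(ℤ³); conversely for p < p_c(ℤ³)
the support EnhancementThresholdLimit gives K with p < p_c(D_{m_K}), G ≤ D_{m_K} ⊔ (finitely many
edges), θ monotone in the graph (SubgraphMonotonicity, in tree) and unchanged in positivity by
finite modification, so θ_G(0, p) = 0 and p_c(G) ≥ p_c(ℤ³). [difficulty: L]
[ChayesChayesDurrett1987, GrimmettPercolation1999]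
#9 DichotomyLink (support) — the two horns are exact negations of each other: CCDGraphZ3 ↔ ¬
SupergraphContinuity (θ ≥ 0 turns θ ≠ 0 into 0 < θ). Proved in the planner's Sketch.lean
(dichotomyLink_provable, 8 lines); filing it makes the refutation link of the target a one-line
citation once CCDGraphZ3 lands. [difficulty: provable-now] [ChayesChayesDurrett1987]
#9 PositiveHorn (support, glue to the target; badge repair 2026-08-16) — ¬CCDGraphZ3 →
SupergraphContinuity: a refutation of the rank-2 crux (no unit-cube supergraph of ℤ³ with
criticalProb G 0 = criticalProb ℤ³ 0 percolates at p_c(ℤ³)) IS the thesis X, so with `closes` the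
conjunct follows from ¬CCDGraphZ3 by two proved edges. The only honest edge into the target: the
cruxes of this route build ¬X, and X has no decomposition of its own (a proof of X would be a same-p
supercritical criterion uniform over the class). Proved in the planner's Sketch.lean
(positiveHorn_provable, 6 lines: contrapose, θ = μ.real(…) ≥ 0). [deps: CCDGraphZ3,
SupergraphContinuity] [difficulty: provable-now] [ChayesChayesDurrett1987]

TWO-LAYER PLAN. Foreseen glued splits (k ≤ 3, depth 1), filed only after a crux closes or stalls:
CCDGraphZ3 ⇐ DecoratedSlabsSupercritical → SlabsToBlocks →
EnhancementThresholdLimit → CCDGraphZ3 (already typed as the support ShellGluing; becomes the formal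
split once rank 4 or 5 lands);
DecoratedSlabsSupercritical ⇐ SlabEnhancementGain (AG differential inequality for S_K(D_m) ⊋
S_K(ℤ³), constants uniform in K ≥ K₀(m),
on the in-tree EnhancementAGLine) → GMGapClosure (PROVED GM: p_c(S_K(ℤ³)) ↓ p_c(ℤ³)) →
DecoratedSlabsSupercritical; SlabsToBlocks ⇐
CrossingClusterExistence (clause (a), in-tree StaticRenormalizationSlabs Lemma (7.78) ported to D_m)
→ LocalUniquenessPeeling (clause (b),
Lemma (7.89)-type with p′ < p sprinkling inside the supercritical slab regime) → SlabsToBlocks;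
CCDGraphZ2 (now a support: helpers ride with --supports; a formal split only if it is re-promoted) ⇐
PlanarStrictEnhancement →
DualCircuitSummability → CCDGraphZ2. On the positive horn nothing is decomposed: a proof of X would
have to run a same-p supercritical
criterion uniformly over the class, which no card proposes. Its single typed edge is the glue
PositiveHorn (¬CCDGraphZ3 → X): the target is reached by REFUTING rank 2, never by splitting X.

KILL CRITERIA. CCDGraphZ3 proved ⇒ X refuted (DichotomyLink): close `refuted:SupergraphContinuity` —
the intended informative outcome; the refuting
theorem enters `ledger negatives` as the barrier "unit-cube supergraphs of ℤ³ with unchanged p_c can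
percolate at p_c" and is handed to the
refuters of every positive route whose cruxes are graph-general (PercOpenSupercrit,
PercFiniteBoxLRO, PercNearOneGluing). X proved ⇒ the
conjunct closes and CCDGraphZ3/ShellGluing die (then DecoratedSlabsSupercritical or SlabsToBlocks is
false for some m — itself worth
recording). DecoratedSlabsSupercritical refuted for all large m (no slab of D_m strictly
supercritical at p_c(ℤ³)) kills the engine: pivot
to the full-lattice variant (p_c(D_m) < p_c(ℤ³) by Martineau–Severo Prop 4.2 + a CMT-type
supercritical sharpness for quasi-transitive
polynomial growth) via --restate, else close `refuted:DecoratedSlabsSupercritical`. SlabsToBlocks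
refuted as stated (non-summable bad
blocks at a slab-supercritical p, e.g. through boundary-hugging paths in clause (b)) forces a
--restate to Grimmett's weaker block event
(uniqueness for paths meeting B(x,n) only), not a close. CCDGraphZ2 refuted would contradict the
CCD87 mechanism in its home dimension:
close `refuted:CCDGraphZ2`. A published graph rough-isometric to ℤ^d with p_c = p_c(ℤ^d) percolating
at p_c makes ¬X `known`: vendor it
as a Literature barrier and close superseded. A proof of θ(p_c) = 0 on ℤ³ elsewhere moots the
staffing but refutes nothing here.

NOT DECOMPOSED YET. The AG differential inequality in slabs and its K-uniformity, and the GM-port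
alternative (children of rank 4); clauses (a)/(b) of the
static renormalisation as separate lemmas (children of rank 5); the 2-d strictness / duality /
circuit lemmas (helpers of the support CCDGraphZ2, attached with --supports); the
bookkeeping inside ShellGluing (product-measure marginal transfer for events of D^{(x)}-edges, block
geometry of dyadic annuli, finite
modification and graph-monotonicity of θ) — helper lemmas riding with --supports, never items; the
density-zero remark θ_G(x; p_c) → 0
of the card (S4) is dropped: it would require θ_{ℤ³}(p_c) = 0 itself. No positive-horn decomposition
(see Two-layer plan).

CHEAPEST FALSIFIER. (1) Lookup, re-run 2026-08-15 (below): is a bounded-degree graph rough-isometric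
to ℤ^d with p_c = p_c(ℤ^d) and θ(p_c) > 0 already in
print? Nothing beyond CCD87 (parameter-inhomogeneous, d = 2), Grimmett's log-wedge (Thm (11.55):
subgraph, p_c shifted, vendored today
as LogWedgePercolatingAtCriticality) and Angel–Hutchcroft (exponential growth). (2) Zhang1994 (an
enhanced LINE in ℤ² does not percolate
at p = 1/2) is the cheapest sanity check of the design: decorations must have full dimension in
every shell, as they do here; a refuter
should confirm that the rank-3 gadget (diagonals on a periodic family of LINES of the plane, density
1/m_k of faces) is a 2-dimensional
periodic enhancement and not a Zhang-type lower-dimensional one. (3) A 10-minute Monte-Carlo (kit,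
refuter): box-crossing
probabilities of ℤ² + NE-diagonals on the lines 8 ∣ x₀ − x₁ at p = 1/2 must drift to 1 with the
scale; and of D_4 ⊂ ℤ³ at p = 0.2488 in
slabs of width 8–16, crossing probabilities increasing with the lateral size. Not run here (hub
compute-free).

NUMBERS. p_c(ℤ³, bond) ≈ 0.2488126 (numerical, Wang–Zhou–Zhang–Garoni–Deng 2013); p_c(ℤ², bond) =
1/2 (Kesten; named fact kesten_criticalProb_Z2);
bond threshold of the planar square lattice with both diagonals ≈ 0.2503 and of the triangular
lattice 2 sin(π/18) ≈ 0.3473 (so a single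
decorated PLANE of ℤ³ is subcritical on its own at p_c(ℤ³): decorations are spread over shells, not
confined to planes); degrees: ℤ³ 6,
decorated site of D_m 26, G ≤ 26; |B(n)| = (2n+1)³ for every G in the class (same vertex set); GM:
p_c(S_K) ↓ p_c(ℤ³) (PROVED in tree);
θ(p_c) = 0 known for d = 2 and d ≥ 11 (FitznerVanDerHofstad2017), open 3 ≤ d ≤ 10. Items at open: 9
(target, 4 cruxes, 3 supports, assembly). After the badge repairs of 2026-08-16 (rev 7): 10 — target
X; 3 cruxes CCDGraphZ3 (2), DecoratedSlabsSupercritical (4), SlabsToBlocks (5); 5 supports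
EnhancementThresholdLimit, ShellGluing, DichotomyLink, PositiveHorn (glue into the target),
CCDGraphZ2 (planar warm-up); assembly.

DEFINITION REQUESTS. None. The decorated lattice D_m is inlined (`zdGraph 3 ⊔ SimpleGraph.fromRel
…`) in each statement; slabs and boxes are inline sets;
criticalProb / theta / bondPercolation / openConnIn / criticalProbI are prelude declarations (all
sorry-free; the route's cone has no
unproved named fact). A prover may introduce `decoratedLattice m` in the Theorems file and prove the
items by `show`.

Novelty: Searches (2026-08-15): `lit search --hybrid "percolation at criticality bounded degree graph rough
isometry invariance critical point unchanged" --no-graph` (12 held books: Grimmett1999 pp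
9/246/295/269, BollobasRiordan2006, HeydenreichVanDerHofstad2017, Grimmett 2010 — nothing
graph-inhomogeneous at fixed p); `lit galaxy search "percolation at criticality" --star all` (22
rows: Garban–Steif, Steif's dynamical survey, Dewan–Muirhead one-arm, fractal percolation — no
polynomial-growth deterministic witness); `lit galaxy search "not a quasi-isometry invariant" --star
all` (7 rows, all geometric group theory); `lit search --source crossref "inhomogeneous percolation
incipient infinite cluster enhancement sparse defects critical point"` (11: CCD87
doi:10.1088/0305-4470/20/6/034, Kesten 1986 IIC, Járai 2003, Michelen 2019 GW trees — none
graph-inhomogeneous); openalex (429 budget exhausted) and arxiv (0) remote legs down; in tree: the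
TreesPercolatingAtCriticality audit gen 1 (LogWedgePercolatingAtCriticality vendored today: "only
homogeneity or geometry finer than growth — rough-isometry to ℤ^d, d-dimensional isoperimetry,
p_c(G) = p_c(ℤ^d) — remains uncatalogued"), 55 Theses of the sub (only PercPotemkinWeaver
negative-side, measure not graph), `ledger negatives` (6 items, none near), the card's own refuter
audit (new-combination, 2026-08-15T06:22Z).
Nearest prior art found: ChayesChayesDurrett1987 Thm 2 (doi:10.1088/0305-4470/20/6/034;
position-dependent densities p_c + ζ^{-1}(  [refs: 10.1088/0305-4470/20/6/034, 1710.03003, doi:10.1088/0305-4470/20/6/034, Grimmett1999, BollobasRiordan2006, HeydenreichVanDerHofstad2017, ChayesChayesDurrett1987, GrimmettPercolation1999, AngelHutchcroft2018, Zhang1994, AizenmanGrimmett1991, MartineauSevero2019]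

Barriers (technique_class: counterexample graph-enhancement static-renormalisation): - technique_class: counterexample graph-enhancement static-renormalisation
- Literature.Barriers.CriticalPhenomena.TreesPercolatingAtCriticality: SHARPENED, not evaded — ¬X is
a witness inside the one class its audit (CriticalTreesExponentialGrowth,
LogWedgePercolatingAtCriticality, 2026-08-15) lists as uncatalogued: rough-isometric to ℤ³, 3-d
isoperimetry, p_c(G) = p_c(ℤ³); X is the statement that this class is safe.
- Literature.Barriers.CriticalPhenomena.SubexponentialGrowthZd: complementary — that entry voids
growth/MTP METHODS on ℤ³; ¬X supplies an actual cubic-growth object percolating at p_c, so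
geometry-only arguments are void too; X's proof, if any, must use p_c(G) = p_c(ℤ³) quantitatively.
- Literature.Barriers.CriticalPhenomena.AmenableInvariantPercolation: every G in the class is
amenable with i.i.d. edges and an a.s. unique infinite cluster (Burton–Keane in tree); the dichotomy
tests whether amenability + independence + uniqueness force θ(p_c) = 0 without transitivity —
consistent with, and sharper than, the entry.
- Literature.Barriers.CriticalPhenomena.SprinklingRenormalisation: used legitimately on the negative
horn — on shell k the decorated lattice is STRICTLY slab-supercritical at p_c(ℤ³) (rank 4), so the
peeling/sprinkling of rank 5 has room p_c(ℤ³) − p_c(S_K(D_{m_k})) > 0 at fixed k; no η → 0 limit is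
taken and no block step reconnects to examined regions of critical ℤ³ at the same p.
- Literature.Barriers.CriticalPhenomena.SlabLimitUniformControl: not me

History (route lifecycle, newest last):
- 2026-08-16T03:58:45Z · AUTO-CRUX (backfill): SupergraphContinuity — hypotheses of the deciding theorem that nothing in the route derives are cruxes (operator:999:1085951)
- 2026-08-22T11:59:46Z · DORMANT — reconciler: no traction for 5.3 d (last activity item-evidence-added at 2026-08-17T03:51:08Z); parked, not closed — `ledger route dormant route-CriticalPhenomen (operator:999:4149868)
- 2026-08-23T15:08:34Z · REACTIVATED — reconciler: reactivated — activity item-proof-filed at 2026-08-23T13:07:03Z after parking at 2026-08-22T11:59:46Z (operator:999:2525470)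
- 2026-08-25T22:27:37Z · BROKEN — SupergraphContinuity (stmt-CriticalPhenomena-11898, crux) refuted by Summit.CriticalPhenomena.PercolationContinuityZ3.Theorems.CCDShell.not_SupergraphContinuity @ d7a65794e4b5 (prover-prim-rsw3-p2-g37-0)
- 2026-08-28T22:31:41Z · CLOSED refuted — refuted:stmt-CriticalPhenomena-11898 (SupergraphContinuity) by Summit.CriticalPhenomena.PercolationContinuityZ3.Theorems.CCDShell.not_SupergraphContinuity (grace expired, auto-close) (gate)

sub-problem: PercolationContinuityZ3 · status: closed(refuted) · opened planner-plancard-CriticalPhenomena-Percolatio-67f8f5b4-g2-0 2026-08-15T18:45:53Z · rev 8 · ledger route-CriticalPhenomena-PercSupergraphDichotomy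
GENERATED by the gate from the ledger (D-0016/17). Provers cite these decls: `theorem foo : Summit.CriticalPhenomena.PercolationContinuityZ3.Theses.PercSupergraphDichotomy.<Decl> := …` in Summits/CriticalPhenomena/PercolationContinuityZ3/Theorems/<Name>.lean.
-/

namespace Summit.CriticalPhenomena.PercolationContinuityZ3.Theses.PercSupergraphDichotomy

open scoped BigOperators Topology Manifold Classical MeasureTheory ProbabilityTheory Matrix InnerProductSpace ComplexConjugate ContinuousMap
open Filter Set Function TopologicalSpace MeasureTheory

attribute [summit_statement] _root_.PercolationContinuityZ3

/-- item stmt-CriticalPhenomena-11898 · crux (kind.auto-crux: conjecture-grade) · rank 0 · closed · refuted by Summit.CriticalPhenomena.PercolationContinuityZ3.Theorems.CCDShell.not_SupergraphContinuity @ e94f6068e86b (prover) · by planner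
why it might fail: Expected FALSE: CCDGraphZ3 (rank 2) is exactly ¬X (DichotomyLink) — density-zero nested unit-cube decorations, strictly supercritical shell by shell at p_c(ℤ³), glued CCD-style; X survives only if the periodic enhancements D_m are not slab-supercritical at p_c(ℤ³).
sources: ChayesChayesDurrett1987, AizenmanGrimmett1991, GrimmettMarstrand1990, HeydenreichVanDerHofstad2017, BenjaminiSchramm1996
[target] X — every simple graph G with ℤ³ ≤ G ≤ unit-cube graph (extra edges only between sites at
sup-distance 1) and criticalProb G 0 = criticalProb ℤ³ 0 has θ_G(0; p_c(ℤ³)) = 0 (positive horn of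
the dichotomy; instantiates to the conjunct at G = ℤ³). -/
@[route_item "route-CriticalPhenomena-PercSupergraphDichotomy"]
def SupergraphContinuity : Prop :=
  ∀ G : SimpleGraph (Literature.Probability.LatticeModels.Site 3), Literature.Probability.LatticeModels.zdGraph 3 ≤ G → (∀ x y : Literature.Probability.LatticeModels.Site 3, G.Adj x y → ∀ i, |x i - y i| ≤ 1) → Literature.Probability.Percolation.criticalProb G 0 = Literature.Probability.Percolation.criticalProb (Literature.Probability.LatticeModels.zdGraph 3) 0 → Literature.Probability.Percolation.theta G 0 (Literature.Probability.Percolation.criticalProbI 3) = 0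

/-- item stmt-CriticalPhenomena-11899 · aside · rank 2 · closed · proved by Summit.CriticalPhenomena.PercolationContinuityZ3.Theorems.CCDShell.ccdGraphZ3_proof @ 1fe33e62dc5b (prover) · by planner
why it might fail: Only through the engine: needs each periodic decoration D_m strictly slab-supercritical at p_c(ℤ³) (rank 4) and summable bad blocks on D_m (rank 5); if AG's gain does not beat the GM slab gap for any m the shell gluing has nothing to run on.
sources: ChayesChayesDurrett1987, AizenmanGrimmett1991, GrimmettMarstrand1990, GrimmettPercolation1999, Pisztora1996, AngelHutchcroft2018
[crux] the Chayes–Chayes–Durrett graph over ℤ³ (card r2; = ¬X): a unit-cube supergraph G of ℤ³ (same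
vertices, extra edges only between sites at sup-distance 1) with criticalProb G 0 = criticalProb ℤ³
0 and θ_G(0; p_c(ℤ³)) > 0. Intended G: ℤ³ decorated on dyadic shells [2^{J_k}, 2^{J_{k+1}}) by the
periodic 26-neighbour gadget at the sites of (m_k ℤ)³, m_k = 2^k m₀ (nested patterns D_{m_{k+1}} ≤
D_{m_k}), radii J_k chosen AFTER the patterns so that the bad-block probabilities of shell k sum to
≤ 2^{-k}. [deps: DecoratedSlabsSupercritical, SlabsToBlocks, EnhancementThresholdLimit, ShellGluing]
[difficulty: XL] -/
@[route_item "route-CriticalPhenomena-PercSupergraphDichotomy"]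
def CCDGraphZ3 : Prop :=
  ∃ G : SimpleGraph (Literature.Probability.LatticeModels.Site 3), Literature.Probability.LatticeModels.zdGraph 3 ≤ G ∧ (∀ x y : Literature.Probability.LatticeModels.Site 3, G.Adj x y → ∀ i, |x i - y i| ≤ 1) ∧ Literature.Probability.Percolation.criticalProb G 0 = Literature.Probability.Percolation.criticalProb (Literature.Probability.LatticeModels.zdGraph 3) 0 ∧ 0 < Literature.Probability.Percolation.theta G 0 (Literature.Probability.Percolation.criticalProbI 3)

-- `CCDGraphZ3` holds: proved by `Summit.CriticalPhenomena.PercolationContinuityZ3.Theorems.CCDShell.ccdGraphZ3_proof` @ 1fe33e62dc5b (its module imports this route file, so no `_holds` link can be stated here).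

/-- item stmt-CriticalPhenomena-11900 · support · rank 3 · closed · moot by None · by planner
why it might fail: Needs p_c(D)+p_c(D*)=1 for the 2-fold-symmetric decorated planar lattice (BollobasRiordan2008's symmetry hypotheses must cover it) or an RSW theory for it, plus strict p_c(D) < 1/2; a gadget lacking the symmetry breaks the duality step.
sources: ChayesChayesDurrett1987, BollobasRiordan2008, Kesten1982, AizenmanGrimmett1991, DuminilCopinTassionCMP2016, Zhang1994
[crux] planar warm-up (card r4): a unit-square supergraph G of ℤ² (extra edges only between sites at
sup-distance 1) with criticalProb G 0 = criticalProb ℤ² 0 and θ_G(0; p_c(ℤ²)) > 0. Intended: one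
NE-diagonal per face on the lines m_k ∣ x₀ − x₁ (still PLANAR, 2-fold symmetric, period m_k),
sparser on outer dyadic shells; on shell k the decorated planar lattice is strictly supercritical at
1/2 (planar AG / Kesten ch. 10 close-packing inequality), its planar dual strictly subcritical
(p_c(D)+p_c(D*) = 1, BollobasRiordan2008; quasi-transitive sharpness PROVED in tree), so open
circuits in dyadic annuli fail summably and glue by planarity — CCD87's proof with the graph in
place of the parameter. [difficulty: L] -/
@[route_item "route-CriticalPhenomena-PercSupergraphDichotomy"]
def CCDGraphZ2 : Prop :=
  ∃ G : SimpleGraph (Literature.Probability.LatticeModels.Site 2), Literature.Probability.LatticeModels.zdGraph 2 ≤ G ∧ (∀ x y : Literature.Probability.LatticeModels.Site 2, G.Adj x y → ∀ i, |x i - y i| ≤ 1) ∧ Literature.Probability.Percolation.criticalProb G 0 = Literature.Probability.Percolation.criticalProb (Literature.Probability.LatticeModels.zdGraph 2) 0 ∧ 0 < Literature.Probability.Percolation.theta G 0 (Literature.Probability.Percolation.criticalProbI 2)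

/-- item stmt-CriticalPhenomena-11901 · aside · rank 4 · closed · proved by Summit.CriticalPhenomena.PercolationContinuityZ3.Theorems.PercSupergraphDichotomyDecoratedSlabsSupercritical.decoratedSlabsSupercritical_proof @ 7d98b1f82a9a (prover) · by planner
why it might fail: Needs the AG gain in slabs bounded below uniformly in the width K (to beat the GM gap p_c(S_K)−p_c → 0) or a Grimmett–Marstrand theorem for the quasi-transitive D_m; both expected, neither written (BBR 1402.0834 Thm 3 closes AG's gap for bond models: only the slab-visibility half is open).
sources: AizenmanGrimmett1991, GrimmettMarstrand1990, GrimmettPercolation1999, BalisterBollobasRiordan2014, MartineauSevero2019, ContrerasMartineauTassion2024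
[crux] for every period m ≥ 1 the decorated lattice D_m := ℤ³ ⊔ {all unit-cube edges at the sites of
(mℤ)³} has a slab S_K = {0 ≤ x₂ ≤ K} whose induced graph has critical point (at the origin) STRICTLY
below p_c(ℤ³) (card r3/S3 in the refuter's fixed-pattern form; no uniformity in m). Two proofs
foreseen: (i) Grimmett–Marstrand for ℤ³ (PROVED in tree) plus an Aizenman–Grimmett gain p_c(S_K(ℤ³))
− p_c(S_K(D_m)) ≥ δ(m) > 0 uniform in K ≥ K₀(m); (ii) port GM's block theorem to the mℤ³-periodic,
hyperoctahedrally symmetric D_m and use AG / Martineau–Severo Prop 4.2 on the full lattice.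
[difficulty: L] -/
@[route_item "route-CriticalPhenomena-PercSupergraphDichotomy"]
def DecoratedSlabsSupercritical : Prop :=
  ∀ m : ℕ, 1 ≤ m → let D : SimpleGraph (Literature.Probability.LatticeModels.Site 3) := Literature.Probability.LatticeModels.zdGraph 3 ⊔ SimpleGraph.fromRel (fun x y : Literature.Probability.LatticeModels.Site 3 => (∀ i, (m : ℤ) ∣ x i) ∧ ∀ i, |x i - y i| ≤ 1); ∃ K : ℕ, Literature.Probability.Percolation.criticalProb (D.induce {x : Literature.Probability.LatticeModels.Site 3 | 0 ≤ x 2 ∧ x 2 ≤ K}) ⟨0, by simp⟩ < Literature.Probability.Percolation.criticalProb (Literature.Probability.LatticeModels.zdGraph 3) 0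

-- `DecoratedSlabsSupercritical` holds: proved by `Summit.CriticalPhenomena.PercolationContinuityZ3.Theorems.PercSupergraphDichotomyDecoratedSlabsSupercritical.decoratedSlabsSupercritical_proof` @ 7d98b1f82a9a (its module imports this route file, so no `_holds` link can be stated here).

/-- item stmt-CriticalPhenomena-11902 · aside · rank 5 · closed · moot by None · by planner
why it might fail: Thm (7.61)/Lemma (7.89) (crossing cluster + local uniqueness by peeling with slab seeds and p′<p sprinkling) are written for ℤ^d using all its symmetries; D_m is only mℤ³-periodic, and (b) is asked for boundary-hugging paths of B(x,3n) at a summable rate.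
sources: GrimmettPercolation1999, Pisztora1996, GrimmettMarstrand1990, ContrerasMartineauTassion2024
[crux] static renormalisation for the decorated lattices (Grimmett 1999 Thm (7.61) / Pisztora ported
to D_m): if some slab of D_m has critical point strictly below p, then at parameter p the block
events — (a) the box B(x,n), n = 2^j, contains an open cluster joining, inside B(x,n), the two
opposite faces in each of the three directions; (b) any two open paths inside B(x,3n), each of
sup-extent ≥ n, are joined by an open path inside B(x,3n) — fail with probability whose supremum
over the centre x is summable along the dyadic scales (exponential in n expected; periodicity makes
the supremum a finite maximum). The fixed-pattern engine of the shell gluing. [deps: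
DecoratedSlabsSupercritical] [difficulty: XL] -/
@[route_item "route-CriticalPhenomena-PercSupergraphDichotomy"]
def SlabsToBlocks : Prop :=
  ∀ m : ℕ, 1 ≤ m → let D : SimpleGraph (Literature.Probability.LatticeModels.Site 3) := Literature.Probability.LatticeModels.zdGraph 3 ⊔ SimpleGraph.fromRel (fun x y : Literature.Probability.LatticeModels.Site 3 => (∀ i, (m : ℤ) ∣ x i) ∧ ∀ i, |x i - y i| ≤ 1); ∀ p : unitInterval, (∃ K : ℕ, Literature.Probability.Percolation.criticalProb (D.induce {x : Literature.Probability.LatticeModels.Site 3 | 0 ≤ x 2 ∧ x 2 ≤ K}) ⟨0, by simp⟩ < p) → Summable (fun j : ℕ => ⨆ x : Literature.Probability.LatticeModels.Site 3, (Literature.Probability.Percolation.bondPercolation D p).real {ω | (∃ a ∈ {y : Literature.Probability.LatticeModels.Site 3 | ∀ i, |y i - x i| ≤ 2 ^ j}, ∀ i : Fin 3, ∃ y ∈ {y : Literature.Probability.LatticeModels.Site 3 | ∀ i, |y i - x i| ≤ 2 ^ j}, ∃ z ∈ {y : Literature.Probability.LatticeModels.Site 3 | ∀ i, |y i - x i|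 ≤ 2 ^ j}, y i = x i - 2 ^ j ∧ z i = x i + 2 ^ j ∧ ω ∈ Literature.Probability.Percolation.openConnIn {y : Literature.Probability.LatticeModels.Site 3 | ∀ i, |y i - x i| ≤ 2 ^ j} a y ∧ ω ∈ Literature.Probability.Percolation.openConnIn {y : Literature.Probability.LatticeModels.Site 3 | ∀ i, |y i - x i| ≤ 2 ^ j} a z) ∧ (∀ a a' b b' : Literature.Probability.LatticeModels.Site 3, ω ∈ Literature.Probability.Percolation.openConnIn {y : Literature.Probability.LatticeModels.Site 3 | ∀ i, |y i - x i| ≤ 3 * 2 ^ j} a a' → ω ∈ Literature.Probability.Percolation.openConnIn {y : Literature.Probability.LatticeModels.Site 3 | ∀ i, |y i - x i| ≤ 3 * 2 ^ j} b b' → (∃ i, (2 : ℤ) ^ j ≤ |a i - a' i|) → (∃ i, (2 : ℤ) ^ j ≤ |b i - b' i|) → ω ∈ Literature.Probability.Percolation.openConnIn {y : Literature.Probability.LatticeModels.Site 3 | ∀ i, |y i - x i| ≤ 3 * 2 ^ j} a b)}ᶜ)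

/-- item stmt-CriticalPhenomena-11903 · support · rank 9 · closed · proved by Summit.CriticalPhenomena.PercolationContinuityZ3.Theorems.EnhancementThresholdLimit.enhancementThresholdLimit_proof @ ab91f6b56309 (prover) · by planner
sources: GrimmettPercolation1999, DuminilCopinTassionCMP2016, AntunovicVeselic2007
[support] the critical points of the decorated lattices tend to p_c(ℤ³) as the decoration rarefies:
for every real p < p_c(ℤ³) there is M with p < p_c(D_m) for all m ≥ M (card S2). Proof: at p′ ∈ (p,
p_c(ℤ³)) the ℤ³-susceptibility is finite (PROVED quasi-transitive sharpness), so a self-avoiding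
open path of D_m decomposes into edge-disjoint ℤ³-segments separated by gadget edges at decorated
sites pairwise ≥ m − 2 apart; BK gives a branching bound with mean offspring ≤ 27·26·Σ_{‖w‖≥m−2}
τ_{p′}(w) → 0, hence θ_{D_m}(p′) = 0 and p < p′ ≤ p_c(D_m) for m ≥ M(p′). [difficulty: M] -/
@[route_item "route-CriticalPhenomena-PercSupergraphDichotomy"]
def EnhancementThresholdLimit : Prop :=
  ∀ p : ℝ, p < Literature.Probability.Percolation.criticalProb (Literature.Probability.LatticeModels.zdGraph 3) 0 → ∃ M : ℕ, ∀ m : ℕ, M ≤ m → p < Literature.Probability.Percolation.criticalProb (Literature.Probability.LatticeModels.zdGraph 3 ⊔ SimpleGraph.fromRel (fun x y : Literature.Probability.LatticeModels.Site 3 => (∀ i, (m : ℤ) ∣ x i) ∧ ∀ i, |x i - y i| ≤ 1)) 0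

-- `EnhancementThresholdLimit` holds: proved by `Summit.CriticalPhenomena.PercolationContinuityZ3.Theorems.EnhancementThresholdLimit.enhancementThresholdLimit_proof` @ ab91f6b56309 (its module imports this route file, so no `_holds` link can be stated here).

/-- item stmt-CriticalPhenomena-11904 · support · rank 9 · closed · proved by Summit.CriticalPhenomena.PercolationContinuityZ3.Theorems.CCDShell.shellGluing_proof @ 3a967e1c2da4 (prover) · by planner
sources: ChayesChayesDurrett1987, GrimmettPercolation1999
[support] glue of the foreseen split of CCDGraphZ3 (the CCD shell construction with patterns fixed
first and radii chosen afterwards): DecoratedSlabsSupercritical → SlabsToBlocks →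
EnhancementThresholdLimit → CCDGraphZ3. Content: nested patterns m_k = 2^k m₀; by ranks 4–5 at p =
p_c(ℤ³) the bad-block suprema ε_{m_k}(2^j) are summable in j, so choose J_k ↑ with Σ_{j ≥ J_k − 1}
ε_{m_k}(2^{j−3}) ≤ 2^{−k}/C (C = blocks of scale 2^{j−3} per dyadic annulus); G = ℤ³ ⊔ (gadget edges
of D_{m_k} inside shell 2^{J_k} ≤ ‖x‖ < 2^{J_{k+1}}); evaluate each block on ω ∩ E(D^{(x)}), D^{(x)}
the COARSEST pattern meeting B(x, 3·2^{j−3}) (its edges lie in G by nestedness; equal product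
marginals); neighbouring and cross-scale good blocks glue through clause (b) of the finer block; so
with positive probability all blocks beyond a finite annulus are good, some vertex percolates, and
θ_G(0) > 0 by theta_pos_of_adj (PROVED in tree); hence p_c(G) ≤ p_c(ℤ³); conversely for p < p_c(ℤ³)
the support EnhancementThresholdLimit gives K with p < p_c(D_{m_K}), G ≤ D_{m_K} ⊔ (finitely many
edges), θ monotone in the graph (SubgraphMonotonicity, in tree) and unchanged in positivity by
finite modification, so θ_G(0, p) -/
@[route_item "route-CriticalPhenomena-PercSupergraphDichotomy"]
def ShellGluing : Prop :=
  DecoratedSlabsSupercritical → SlabsToBlocks → EnhancementThresholdLimit → CCDGraphZ3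

-- `ShellGluing` holds: proved by `Summit.CriticalPhenomena.PercolationContinuityZ3.Theorems.CCDShell.shellGluing_proof` @ 3a967e1c2da4 (its module imports this route file, so no `_holds` link can be stated here).

/-- item stmt-CriticalPhenomena-11905 · support · rank 9 · closed · proved by Summit.CriticalPhenomena.PercolationContinuityZ3.Theorems.PercSupergraphDichotomyDichotomyLink.dichotomyLink_proof @ 5aefe60a5ebd (prover) · by planner
sources: ChayesChayesDurrett1987
[support] the two horns are exact negations of each other: CCDGraphZ3 ↔ ¬ SupergraphContinuity (θ ≥
0 turns θ ≠ 0 into 0 < θ). Proved in the planner's Sketch.lean (dichotomyLink_provable, 8 lines);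
filing it makes the refutation link of the target a one-line citation once CCDGraphZ3 lands.
[difficulty: provable-now] -/
@[route_item "route-CriticalPhenomena-PercSupergraphDichotomy"]
def DichotomyLink : Prop :=
  CCDGraphZ3 ↔ ¬ SupergraphContinuity

-- `DichotomyLink` holds: proved by `Summit.CriticalPhenomena.PercolationContinuityZ3.Theorems.PercSupergraphDichotomyDichotomyLink.dichotomyLink_proof` @ 5aefe60a5ebd (its module imports this route file, so no `_holds` link can be stated here).

/-- item stmt-CriticalPhenomena-14281 · support · rank 9 · closed · proved by Summit.CriticalPhenomena.PercolationContinuityZ3.Theorems.PercSupergraphDichotomyPositiveHorn.positiveHorn_proof @ 3a592c63e608 (prover) · by planner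
sources: ChayesChayesDurrett1987
[support] [glue] the positive horn of the dichotomy reaches the target: a refutation of the rank-2
crux CCDGraphZ3 (no simple graph G with ℤ³ ≤ G ≤ unit-cube graph and criticalProb G 0 = criticalProb
ℤ³ 0 has θ_G(0; p_c(ℤ³)) > 0) IS supergraph continuity X = SupergraphContinuity (θ_G = μ.real(…) ≥ 0
turns ¬(0 < θ_G) into θ_G = 0). With `closes` the route proves the conjunct exactly when CCDGraphZ3
is refuted, and (DichotomyLink) refutes X exactly when CCDGraphZ3 is proved; no finer decomposition
of X is claimed. Proved in the planner's Sketch.lean (positiveHorn_provable, 6 lines: intro,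
by_contra, exact ⟨G, …, lt_of_le_of_ne measureReal_nonneg⟩). [deps: CCDGraphZ3,
SupergraphContinuity] [difficulty: provable-now] -/
@[route_item "route-CriticalPhenomena-PercSupergraphDichotomy"]
def PositiveHorn : Prop :=
  ¬ CCDGraphZ3 → SupergraphContinuity

-- `PositiveHorn` holds: proved by `Summit.CriticalPhenomena.PercolationContinuityZ3.Theorems.PercSupergraphDichotomyPositiveHorn.positiveHorn_proof` @ 3a592c63e608 (its module imports this route file, so no `_holds` link can be stated here).

/-- item stmt-CriticalPhenomena-11906 · assembly · rank 1 · closed · proved by Summit.CriticalPhenomena.PercolationContinuityZ3.Theorems.PercSupergraphDichotomyAssembly.assembly_proof @ f9c60944435a (prover) · by planner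
sources: ChayesChayesDurrett1987, Grimmett1999
[assembly] SupergraphContinuity → PercolationContinuityZ3 (instantiate X at G = ℤ³). -/
@[route_item "route-CriticalPhenomena-PercSupergraphDichotomy"]
def Assembly : Prop :=
  SupergraphContinuity → PercolationContinuityZ3

-- `Assembly` holds: proved by `Summit.CriticalPhenomena.PercolationContinuityZ3.Theorems.PercSupergraphDichotomyAssembly.assembly_proof` @ f9c60944435a (its module imports this route file, so no `_holds` link can be stated here).

/-! D-0027 §2.1 — DECIDING THEOREM (planner-authored via `route open/edit --closes-file`; by planner-plancard-CriticalPhenomena-Percolatio-67f8f5b4-g2-0 2026-08-15T18:45:53Z) — ARCHIVED: route closed (refuted) 2026-08-28T22:31:41Z; kept so importers keep building: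
its hypotheses are this route's items and its conclusion the sub-problem Statement (glue_lint), and it elaborates with this file. -/

/-- D-0027 §2.1 deciding theorem of route PercSupergraphDichotomy: instantiate supergraph
continuity (`SupergraphContinuity`, the thesis X) at `G = ℤ³` itself — `ℤ³ ≤ ℤ³`, every
nearest-neighbour edge joins sites at sup-distance `1` (`zdGraph_adj_iff`), and
`p_c(ℤ³) = p_c(ℤ³)` — to get `θ_{ℤ³}(0; p_c(ℤ³)) = 0`, which is `PercolationContinuityZ3`
unfolded (`percolationContinuityZ3_iff`, `criticalProbI`). Pure logic. -/
@[closes "route-CriticalPhenomena-PercSupergraphDichotomy"] theorem closes (hX : SupergraphContinuity) : _root_.PercolationContinuityZ3 := by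
  show Literature.Probability.Percolation.theta (Literature.Probability.LatticeModels.zdGraph 3) 0
      (Literature.Probability.Percolation.criticalProbI 3) = 0
  refine hX _ le_rfl ?_ rfl
  intro x y hxy i
  obtain ⟨j, h | h⟩ := (Literature.Probability.LatticeModels.zdGraph_adj_iff x y).1 hxy
  · rw [h]
    by_cases hij : i = j
    · subst hij; simp
    · simp [Pi.add_apply, hij]
  · rw [h]
    by_cases hij : i = j
    · subst hij; simp
    · simp [Pi.add_apply, hij]

end Summit.CriticalPhenomena.PercolationContinuityZ3.Theses.PercSupergraphDichotomy
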